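import Summits.FinalStateConjecture.FinalStateConjecture.Theorems.ExactKerrEndsTameEscapeToKerrEndsOfStubs
import Summits.FinalStateConjecture.FinalStateConjecture.Theorems.ExactKerrEndsTameEscapeToKerrEndsMinkowskiLeaf
import Literature.Geometry.Lorentzian.StronglyAsymptoticallyFlatADMEnergy
import Literature.Geometry.Lorentzian.StronglyAsymptoticallyFlatADMMomentum
import Literature.Geometry.Lorentzian.VacuumDataDominantEnergy
import Literature.Geometry.Lorentzian.AsymptoticFlatnessProofs
import Literature.Geometry.Lorentzian.SpacetimePositiveMassRigidity
import HarnessLib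

/-!
# Route `ExactKerrEnds`, crux `TameEscapeToKerrEnds` (stmt-FinalStateConjecture-18522), line
# `matched-kerr-solution-map`: stub S2 `NonposMassKerrEnded` from the positive mass theorem

Stub S2 of the registered skeleton `Cruxes/TameEscapeToKerrEnds/Lines/matched_kerr_solution_map.lean`:
an admissible vacuum datum `d` (complete, vacuum constraints, sole Dafermos–Rodnianski end `e` with
mass parameter `M`) with `M ≤ 0` has an exact Kerr end (`InitialDataSet.HasExactKerrEnd`). This is
the spacetime positive mass theorem with its rigidity case, both named facts of `Literature/`:

* `M < 0` is impossible: vacuum data satisfy the dominant energy condition with vanishing sources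
  (`VacuumDataDominantEnergy.lean`), DR-flatness gives asymptotic flatness of order `1`
  (`AsymptoticFlatnessProofs.lean`), ADM energy `E = M` (`StronglyAsymptoticallyFlatADMEnergy.lean`)
  and ADM momentum `P = 0` (`StronglyAsymptoticallyFlatADMMomentum.lean`), so
  `positive_mass_theorem_spacetime` (Eichmair–Huang–Lee–Schoen 2016, Thm. 1) yields
  `0 ≤ |P| ≤ E = M`;
* `M = 0`: the rigid positive energy theorem `positive_mass_rigidity_spacetime` (Beig–Chruściel
  1996, Thm. 4.1) makes `d` the data of a Cauchy hypersurface of Minkowski space, and such data are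
  Kerr-ended with `M = a = 0` (`hasExactKerrEnd_of_cauchyDevelopment_eq_minkowski`,
  `ExactKerrEndsTameEscapeToKerrEndsMinkowskiLeaf.lean`).

Main results: `nonposMassKerrEnded_of_pmt_of_rigidity : positive_mass_theorem_spacetime →
positive_mass_rigidity_spacetime → S2` (S2 verbatim), and with the landed glue
`tameEscapeToKerrEnds_of_matchedKerrGluing_of_nonposMassKerrEnded` (S3a/S3b discharged):
`tameEscapeToKerrEnds_of_matchedKerrGluing_of_pmt_of_rigidity :
S1 → positive_mass_theorem_spacetime → positive_mass_rigidity_spacetime → TameEscapeToKerrEnds`.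
-/

set_option linter.dupNamespace false

noncomputable section

namespace Summit.FinalStateConjecture.FinalStateConjecture.Theorems.ExactKerrEnds

open scoped Manifold ContDiff Topology
open Set Filter Function TopologicalSpace Literature.Geometry.Lorentzian

/-! ### Stub S2: `NonposMassKerrEnded` from the positive mass theorem and its rigidity case -/

/-- **Stub S2 `NonposMassKerrEnded` of crux `TameEscapeToKerrEnds` (stmt-FinalStateConjecture-18522),
line `matched-kerr-solution-map`, from the named facts `positive_mass_theorem_spacetime`
(Eichmair–Huang–Lee–Schoen 2016, Thm. 1) and `positive_mass_rigidity_spacetime` (Beig–Chruściel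
1996, Thm. 4.1).** For an admissible vacuum datum `d` with sole DR end `e` of mass parameter
`M ≤ 0`: `d` satisfies the dominant energy condition with sources of every decay rate
(`satisfiesDominantEnergyCondition_of_mem_admissibleVacuumData`,
`hasSourceDecay_of_mem_admissibleVacuumData`), is asymptotically flat of order `1`
(`IsStronglyAsymptoticallyFlatDR.IsAsymptoticallyFlat_one_holds`), complete, with ADM energy
`E = M` (`IsStronglyAsymptoticallyFlatDR.hasADMEnergy`) and ADM momentum `P = 0`
(`IsStronglyAsymptoticallyFlatDR.hasADMMomentum_zero`); the positive mass theorem gives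
`0 ≤ |P| ≤ E = M`, so `M = 0`; then rigidity makes `d` the data of a Cauchy hypersurface of
Minkowski space, which is Kerr-ended (`hasExactKerrEnd_of_cauchyDevelopment_eq_minkowski`). The
statement is the stub `NonposMassKerrEnded` verbatim, CONDITIONAL on the two named facts.
[cite: BeigChrusciel1996, Thm. 4.1] -/
theorem nonposMassKerrEnded_of_pmt_of_rigidity :
    positive_mass_theorem_spacetime → positive_mass_rigidity_spacetime →
    ∀ (X : Type) [TopologicalSpace X] [ChartedSpace E3 X] [IsManifold (𝓡 3) ∞ X] [T2Space X]
      [SecondCountableTopology X] [ConnectedSpace X],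
      ∀ d ∈ admissibleVacuumData X, ∀ (e : AFEnd X) (M : ℝ), e.IsSoleEnd → M ≤ 0 →
        e.IsStronglyAsymptoticallyFlatDR d M → d.HasExactKerrEnd := by
  intro hpmt hrig X _ _ _ _ _ _ d hd e M hsole hM hDR
  haveI : d.metric.HasLeviCivita := d.metric.hasLeviCivita
  have hDEC : d.SatisfiesDominantEnergyCondition :=
    satisfiesDominantEnergyCondition_of_mem_admissibleVacuumData hd
  have hsrc : ∃ q₀, HasSourceDecay e d q₀ :=
    ⟨1, hasSourceDecay_of_mem_admissibleVacuumData e hd one_pos⟩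
  have hAF : e.IsAsymptoticallyFlat d 1 :=
    (AFEnd.IsStronglyAsymptoticallyFlatDR.IsAsymptoticallyFlat_one_holds e d) hDR
  have hE : e.HasADMEnergy d M := hDR.hasADMEnergy
  -- `M < 0` contradicts the positive mass theorem, so `M = 0`
  have hM0 : M = 0 := by
    by_contra hne
    have hcomplete : d.IsComplete := hd.1.2
    have hP : ∀ i, ∃ p, e.HasADMMomentum d i p := fun i ↦ ⟨0, hDR.hasADMMomentum_zero i⟩
    have key := hpmt X d e hDEC hAF hsrc hsole hcomplete ⟨M, hE⟩ hP
    rw [hE.admEnergy_eq] at key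
    have h0 : (0 : ℝ) ≤ M := (Real.sqrt_nonneg _).trans key
    exact hne (le_antisymm hM h0)
  subst hM0
  obtain ⟨𝒟, h𝒟⟩ := hrig X d e hDEC hAF hsrc hsole hE
  intro _
  exact hasExactKerrEnd_of_cauchyDevelopment_eq_minkowski X d e hsole 𝒟 h𝒟

/-- **The crux `TameEscapeToKerrEnds` from S1 and the positive mass theorem with rigidity**: the
landed glue `tameEscapeToKerrEnds_of_matchedKerrGluing_of_nonposMassKerrEnded` (S3a/S3b discharged)
composed with `nonposMassKerrEnded_of_pmt_of_rigidity` (S2 from the two named facts). What remains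
of the line is S1 (the matched exterior Kerr gluing with a smooth solution map, written out
verbatim as the first hypothesis) and the two printed theorems `positive_mass_theorem_spacetime`,
`positive_mass_rigidity_spacetime`. [cite: BeigChrusciel1996, Thm. 4.1] -/
theorem tameEscapeToKerrEnds_of_matchedKerrGluing_of_pmt_of_rigidity
    (h1 : ∀ (X : Type) [TopologicalSpace X] [ChartedSpace E3 X] [IsManifold (𝓡 3) ∞ X] [T2Space X]
      [SecondCountableTopology X] [ConnectedSpace X], ∀ [Kerr.Facts],
      ∀ d ∈ admissibleVacuumData X, ∀ (e : AFEnd X) (M : ℝ), e.IsSoleEnd → 0 < M →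
        e.IsStronglyAsymptoticallyFlatDR d M →
        ∃ (Rstar : ℝ) (m : ℝ → ℝ) (G : ℝ → InitialDataSet (𝓡 3) X),
          e.R < Rstar ∧ ContinuousOn m (Ioi Rstar) ∧ Tendsto m atTop (𝓝 M) ∧
          SwallowTheDatum.ParametricKerrBurial.SmoothSectionsOn 𝓘(ℝ, ℝ) G
            {p : ℝ × X | Rstar < p.1} ∧
          (∀ R : ℝ, Rstar < R →
            G R ∈ admissibleVacuumData X ∧
              (∀ x ∉ e.far R, SwallowTheDatum.ParametricKerrBurial.AgreeAt (G R) d x) ∧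
              e.IsStronglyAsymptoticallyFlatDR (G R) (m R) ∧
              ∃ (M' a r₀ : ℝ) (hM' : 0 ≤ M') (ψ : exteriorRegion (4 * R) → Kerr.region a r₀)
                (ν : NormalField 𝓘(ℝ, E4) ψ),
                Injective ψ ∧
                (Kerr.smoothMetric M' a r₀).IsSpacelikeImmersion 𝓘(ℝ, E3) ψ ∧
                (Kerr.smoothMetric M' a r₀).IsFutureUnitNormal 𝓘(ℝ, E3)
                  ((Kerr.timeOrientation M' a r₀ hM').ofLE le_top) ψ ν ∧
                (∀ (y : exteriorRegion (4 * R)) (v w : E3),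
                  AFEnd.hCoeff e (G R) (y : E3) v w =
                    Kerr.bilin M' a (ψ y : E4) (mfderiv 𝓘(ℝ, E3) 𝓘(ℝ, E4) ψ y v)
                      (mfderiv 𝓘(ℝ, E3) 𝓘(ℝ, E4) ψ y w)) ∧
                (∀ [(Kerr.smoothMetric M' a r₀).HasLeviCivita] (y : exteriorRegion (4 * R))
                  (v w : E3),
                  AFEnd.kCoeff e (G R) (y : E3) v w =
                    (Kerr.smoothMetric M' a r₀).secondFundamentalForm 𝓘(ℝ, E3) ψ ν y v w)) ∧
          Tendsto (fun R ↦ e.wDist (G R) d) atTop (𝓝 0))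
    (hpmt : positive_mass_theorem_spacetime) (hrig : positive_mass_rigidity_spacetime) :
    Summit.FinalStateConjecture.FinalStateConjecture.Theses.ExactKerrEnds.TameEscapeToKerrEnds :=
  tameEscapeToKerrEnds_of_matchedKerrGluing_of_nonposMassKerrEnded h1
    (nonposMassKerrEnded_of_pmt_of_rigidity hpmt hrig)

end Summit.FinalStateConjecture.FinalStateConjecture.Theorems.ExactKerrEnds

end
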